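import Summits.ResolutionOfSingularities.ResolutionOfSingularities.Theorems.WeightedInvariantE2HomChartOfHomU
import Summits.ResolutionOfSingularities.ResolutionOfSingularities.Theorems.WeightedInvariantE2HomogeneousSpan
import HarnessLib

/-!
# (G-0) HOMOGENEOUS CHART OF THE E2 CENTRE — the composition of record
# `LocalEngine.e2HomogeneousChart : PRungGrHomLE 3 p ι J → E2HomogeneousChartBody p ι J`

[OURS · L1 W4.3 · DOOR `HypersurfaceCentreConstruction` stmt-ResolutionOfSingularities-19897 · E2 tier, centre piece (C-c); registrar
res-L1-w43-plan-1 SPEC (Δ11) rev 9 glue `E2HomogeneousChartBody_of_homU` (…E2HomogeneousChartDefs, p566000) applied to the two landed hands: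
(G-0-U) `e2HomogeneousSpan` (res-D-pv-031, …E2HomogeneousSpan) and (G-0-abc)(+d) `e2HomChartOfHomU` (res-L1-s36-pv-1, …E2HomChartOfHomU p569302).
One-line composition, no mathematics; nothing here is a statement of, or about, the manuscript under adjudication (Hironaka 2017); AI work,
weaker than expert review.]
-/

set_option linter.dupNamespace false

noncomputable section

namespace Summit.ResolutionOfSingularities.ResolutionOfSingularities.Cruxes.HypersurfaceCentreConstruction.LocalEngine

/-- **(G-0) = board item (o47-c-ring) in full: `PRungGrHomLE 3 p ι J → E2HomogeneousChartBody p ι J`** — at every graded orbit-generic position of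
dimension `≤ 3` the (open″)≤3 body holds with HOMOGENEOUS localising element, HOMOGENEOUS parameters and (reg).  Composition of the registrar's glue
`E2HomogeneousChartBody_of_homU` with `e2HomogeneousSpan` ((G-0-U), res-D-pv-031) and `e2HomChartOfHomU` ((G-0-abc)(+d), res-L1-s36-pv-1); this is the
`hG0` input of `e2CentreGlue_of_homChart_hom_scheme` (…E2CentreSchemeGlueDefs). [OURS · SPEC (Δ11) rev 9/10] -/
theorem e2HomogeneousChart (p : ℕ) (hp : p.Prime) (ι : (R : Type) → [CommRing R] → R → Ordinal.{0})
    (J : (R : Type) → [CommRing R] → R → ℕ → Ideal R) (hr : PRungGrHomLE 3 p ι J) : E2HomogeneousChartBody p ι J :=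
  E2HomogeneousChartBody_of_homU p ι J (e2HomogeneousSpan p hp ι J hr) (e2HomChartOfHomU p hp ι J hr)

/-- The same in the `∀ p` shape consumed by `e2CentreGlue_of_homChart_hom_scheme`. [OURS · seam] -/
theorem e2HomogeneousChart_forall :
    ∀ p : ℕ, p.Prime → ∀ (ι : (R : Type) → [CommRing R] → R → Ordinal.{0})
      (J : (R : Type) → [CommRing R] → R → ℕ → Ideal R), PRungGrHomLE 3 p ι J → E2HomogeneousChartBody p ι J :=
  fun p hp ι J hr => e2HomogeneousChart p hp ι J hr

end Summit.ResolutionOfSingularities.ResolutionOfSingularities.Cruxes.HypersurfaceCentreConstruction.LocalEngine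

end
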